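import Summits.CriticalPhenomena.PercolationContinuityZ3.Theorems.PercNearOneGluingNoHeavyLowerTailSahiGoodAxisFalse
import Mathlib.Tactic.Linarith
import Mathlib.Tactic.NormNum
import Mathlib.Tactic.FinCases
import HarnessLib

/-!
# `NoHeavyLowerTail` (crux stmt-CriticalPhenomena-4575): the CHORD-COMPARISON principles are FALSE —
# along the doubled star at bias `9/10` the sectional chord of `E_3` exceeds `3.6·E_3` on every axis, and the six chords together exceed `21·E_3`

Support file (cell `prim-masterthm`, seat P2, generation 19; `--supports stmt-CriticalPhenomena-4575`).  No `sorry`, no named facts,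
standard axioms; a kernel-checked finite computation in the framework of `…SahiGoodAxisFalse` (same six-coin triple, another bias).

THE PRINCIPLES REFUTED.  For a triple `U` of increasing events under the product measure `μ_q`, a coin `a` and the fibre cubic
`Φ_a(s) = E_3(μ_{q[a↦s]})`, the *sectional chord* at `a` is `ch_a := (1−q_a)·Φ_a(0) + q_a·Φ_a(1)` (the `μ_q`-average of the two facet
values of `E_3` along `a`).  Each of the following global statements would give Kahn's Conjecture 5 by a one-line induction on the
number of coins (at an interior point of a coin-minimal counterexample the facet values are `≥ 0`, so the right-hand sides are `≥ 0`):
* **PCB(C)** ("per-coin chord bound"): `ch_a ≤ C·E_3(μ_q)` for every coin `a`, with a universal constant `C`;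
* **CSB** ("chord-sum bound"): `Σ_a ch_a ≤ (m+1)·E_3(μ_q)` on `m` coins (equivalently `W/2 + A₃ ≤ E_3` for the weighted Laplacian
  `W` and the cubic term `A₃` of `…SahiSliceMinimumSumForm`: `Σ_a (ch_a − E_3) = W/2 + A₃`).
In random/exhaustive censuses on `≤ 6` coins these looked sharp and clean (`sup ch_a/E_3 = 2`, `sup Σ_a ch_a/E_3 = m+1`, attained only
in degenerate corners; SAHI-ROUTE.md §4.43), exactly as the chord criterion (B∃)/GA had looked before `…SahiGoodAxisFalse`.

THE WITNESS.  The doubled star of `…SahiGoodAxisFalse` (`ι = Fin 6`, `P = x₀ ∨ x₁`, `Q = x₂ ∨ x₃`, `R = x₄ ∨ x₅`,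
`A = P ∧ (Q ∨ R)`, `B = (P ∨ Q) ∧ R`, `C = Q ∧ (P ∨ R)`), now at bias `q ≡ 9/10`.  With integer weights `w(ω) = 9^{|ω|}`
(`μ_q(ω) = w(ω)/10⁶`): singles `989901`, pairs `980100`, triple `970299`, whence `E_3(μ_q) = 29107999701/10¹⁸`; along every axis the
`1`-section triple has `E_3 = 0` and the `0`-section triple has `E_3 = 1058419791/10¹⁵`, so `ch_a = 105841979100/10¹⁸ > 3.63·E_3(μ_q)`
for all six `a` (`chord_gt`, `not_perCoinChordBound_two`: PCB(2) fails; indeed PCB(C) fails for every `C` along this family as `q → 1`,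
where `Φ_a(s)/Φ_a(0) → (1−s)²`), and `Σ_a ch_a = 6·ch_a > 21.8·E_3(μ_q) > 7·E_3(μ_q)` (`sum_chord_gt`, `not_chordSumBound`: CSB fails).
MECHANISM: a zero top facet approached quadratically — the limiting fibre `(1−s)²` has Bernstein row `(1, 1/3, 0, 0)`, on which the
two-level laws `3β₁ ≥ β₀`, `3β₂ ≥ β₃` (`SahiTwoLevelMinus/Plus`, census-clean, ⟹ Kahn) are both TIGHT, while every chord-type
(linear-weight) comparison fails; only minimum-type statements (the slice minimum principle: `min_{a,b} Φ_a(b) = 0 ≤ E_3` here) and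
critical-point statements (`…SumForm`, `…Laplacian`; this region has no critical points) survive.
HONEST FRAMING: two natural strengthenings are closed in the negative; Kahn's `C_3` / `MasterFamilyNonneg 3`, the slice minimum principle
and the two-level laws remain OPEN.  Axioms standard. [this work]
-/

noncomputable section

open scoped Classical

namespace Summit.CriticalPhenomena.PercolationContinuityZ3.Theorems

namespace SahiChordBoundsFalse

open Finset Function Literature.Combinatorics.Sahi2008
open Literature.Probability.Percolation.DecisionTree (ind ind_of_mem ind_of_not_mem)
open SahiC3Cube (pt)
open SahiCoordinateTwoThirdsFalse (ind_eq_ite)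
open SahiGoodAxisFalse (dsA dsB dsC bA bB bC mem_dsA mem_dsB mem_dsC mem_pt_iff isUpperSet_dsA isUpperSet_dsB isUpperSet_dsC)

/-! ### 1. The bias `9/10` and its integer weights -/

/-- The number `9/10` as a point of `[0,1]`. [this work] -/
def nineTenths : unitInterval := ⟨9 / 10, by norm_num, by norm_num⟩

/-- The constant parameter vector `q ≡ 9/10` on six coins. [this work] -/
def q910 : Fin 6 → unitInterval := fun _ => nineTenths

/-- `(q a : ℝ) = 9/10`. [this work] -/
theorem coe_q910 (a : Fin 6) : ((q910 a : unitInterval) : ℝ) = 9 / 10 := rfl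

/-- Weight letter of bit `i` of the code `j`: `9` if set, `1` if not (numerators of `9/10`, `1/10`). [this work] -/
def bw (j : ℕ) (i : Fin 6) : ℕ := if j.testBit i = true then 9 else 1

/-- `w(j) = ∏_i bw(j,i) = 9^{|ω|}`: `10⁶·μ_q(pt 6 j)`. [this work] -/
def wt (j : ℕ) : ℕ := ∏ i : Fin 6, bw j i

/-- The weight off the coordinate `a`: `∏_{i ≠ a} bw(j,i)` (`10⁵ ×` the conditional weight). [this work] -/
def wtE (a : ℕ) (j : ℕ) : ℕ := ∏ i : Fin 6, if (i : ℕ) = a then 1 else bw j i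

/-- `wtE a j` is the product of the weight letters over the coordinates other than `a`. [this work] -/
theorem wtE_eq (a : Fin 6) (j : ℕ) : (wtE a j : ℝ) = ∏ i ∈ Finset.univ.erase a, (bw j i : ℝ) := by
  rw [wtE, ← Finset.mul_prod_erase Finset.univ _ (Finset.mem_univ a), if_pos rfl, one_mul]
  push_cast
  refine Finset.prod_congr rfl fun i hi => ?_
  rw [if_neg (fun h => Finset.ne_of_mem_erase hi (Fin.ext h))]

/-- One factor of the product weight at `q ≡ 9/10`: `bw/10`. [this work] -/
theorem factor_eq (i : Fin 6) (j : ℕ) :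
    (if i ∈ pt 6 j then ((q910 i : unitInterval) : ℝ) else 1 - ((q910 i : unitInterval) : ℝ)) = (bw j i : ℝ) / 10 := by
  rw [coe_q910]
  by_cases hb : j.testBit i = true
  · rw [if_pos ((mem_pt_iff i j).2 hb)]; simp only [bw, hb, if_true]; push_cast; norm_num
  · rw [if_neg (fun h => hb ((mem_pt_iff i j).1 h))]; simp only [bw, hb]; push_cast; norm_num

/-- The product weight at `q ≡ 9/10` of a coded point is `w(j)/10⁶`. [this work] -/
theorem weight_q910 (j : ℕ) : bernoulliWeight q910 (pt 6 j) = (wt j : ℝ) / 1000000 := by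
  show (∏ i : Fin 6, if i ∈ pt 6 j then ((q910 i : unitInterval) : ℝ) else 1 - ((q910 i : unitInterval) : ℝ)) = _
  rw [Finset.prod_congr rfl fun i _ => factor_eq i j, Finset.prod_div_distrib, Finset.prod_const, Finset.card_univ,
    Fintype.card_fin, wt]
  push_cast
  norm_num

/-- The product weight of `q[a ↦ 1]`: `wtE(a,j)/10⁵` on the face `x_a = 1`, `0` off it. [this work] -/
theorem weight_top (a : Fin 6) (j : ℕ) :
    bernoulliWeight (update q910 a 1) (pt 6 j) = if j.testBit a = true then (wtE a j : ℝ) / 100000 else 0 := by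
  show (∏ i : Fin 6, if i ∈ pt 6 j then ((update q910 a 1 i : unitInterval) : ℝ)
      else 1 - ((update q910 a 1 i : unitInterval) : ℝ)) = _
  rw [← Finset.mul_prod_erase Finset.univ _ (Finset.mem_univ a)]
  have h : ∀ i ∈ Finset.univ.erase a, (if i ∈ pt 6 j then ((update q910 a 1 i : unitInterval) : ℝ)
      else 1 - ((update q910 a 1 i : unitInterval) : ℝ)) = (bw j i : ℝ) / 10 := by
    intro i hi
    rw [update_of_ne (Finset.ne_of_mem_erase hi)]
    exact factor_eq i j
  rw [Finset.prod_congr rfl h, Finset.prod_div_distrib, Finset.prod_const, Finset.card_erase_of_mem (Finset.mem_univ _),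
    Finset.card_univ, Fintype.card_fin, update_self, Set.Icc.coe_one, wtE_eq]
  by_cases hb : j.testBit a = true
  · rw [if_pos ((mem_pt_iff a j).2 hb), if_pos hb]; ring
  · rw [if_neg (fun h => hb ((mem_pt_iff a j).1 h)), if_neg hb]; ring

/-- The product weight of `q[a ↦ 0]`: `wtE(a,j)/10⁵` on the face `x_a = 0`, `0` off it. [this work] -/
theorem weight_bot (a : Fin 6) (j : ℕ) :
    bernoulliWeight (update q910 a 0) (pt 6 j) = if j.testBit a = true then 0 else (wtE a j : ℝ) / 100000 := by
  show (∏ i : Fin 6, if i ∈ pt 6 j then ((update q910 a 0 i : unitInterval) : ℝ)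
      else 1 - ((update q910 a 0 i : unitInterval) : ℝ)) = _
  rw [← Finset.mul_prod_erase Finset.univ _ (Finset.mem_univ a)]
  have h : ∀ i ∈ Finset.univ.erase a, (if i ∈ pt 6 j then ((update q910 a 0 i : unitInterval) : ℝ)
      else 1 - ((update q910 a 0 i : unitInterval) : ℝ)) = (bw j i : ℝ) / 10 := by
    intro i hi
    rw [update_of_ne (Finset.ne_of_mem_erase hi)]
    exact factor_eq i j
  rw [Finset.prod_congr rfl h, Finset.prod_div_distrib, Finset.prod_const, Finset.card_erase_of_mem (Finset.mem_univ _),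
    Finset.card_univ, Fintype.card_fin, update_self, Set.Icc.coe_zero, wtE_eq]
  by_cases hb : j.testBit a = true
  · rw [if_pos ((mem_pt_iff a j).2 hb), if_pos hb]; ring
  · rw [if_neg (fun h => hb ((mem_pt_iff a j).1 h)), if_neg hb]; ring

/-- Expectation at `q ≡ 9/10` as a weighted sum over the codes. [this work] -/
theorem ex_q910 (F : Set (Fin 6) → ℝ) :
    ex (bernoulliWeight q910) F = (1 / 1000000) * ∑ j ∈ Finset.range 64, (wt j : ℝ) * F (pt 6 j) := by
  rw [ex_def, SahiTransportJR.sum_eq_sum_range (m := 6) (fun x => bernoulliWeight q910 x * F x), Finset.mul_sum]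
  refine Finset.sum_congr (by norm_num) fun j _ => ?_
  rw [weight_q910]; ring

/-- Expectation under `q[a ↦ 1]` as a weighted sum over the codes of the face `x_a = 1`. [this work] -/
theorem ex_top (a : Fin 6) (F : Set (Fin 6) → ℝ) :
    ex (bernoulliWeight (update q910 a 1)) F =
      (1 / 100000) * ∑ j ∈ Finset.range 64, (if j.testBit a = true then (wtE a j : ℝ) * F (pt 6 j) else 0) := by
  rw [ex_def, SahiTransportJR.sum_eq_sum_range (m := 6) (fun x => bernoulliWeight (update q910 a 1) x * F x), Finset.mul_sum]
  refine Finset.sum_congr (by norm_num) fun j _ => ?_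
  rw [weight_top]; split_ifs <;> ring

/-- Expectation under `q[a ↦ 0]` as a weighted sum over the codes of the face `x_a = 0`. [this work] -/
theorem ex_bot (a : Fin 6) (F : Set (Fin 6) → ℝ) :
    ex (bernoulliWeight (update q910 a 0)) F =
      (1 / 100000) * ∑ j ∈ Finset.range 64, (if j.testBit a = true then 0 else (wtE a j : ℝ) * F (pt 6 j)) := by
  rw [ex_def, SahiTransportJR.sum_eq_sum_range (m := 6) (fun x => bernoulliWeight (update q910 a 0) x * F x), Finset.mul_sum]
  refine Finset.sum_congr (by norm_num) fun j _ => ?_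
  rw [weight_bot]; split_ifs <;> ring

/-! ### 2. The weighted Boolean sums as natural numbers, and the kernel computations -/

/-- Bulk sum `Σ_{j : c} w(j)`. [this work] -/
def SF (c : ℕ → Bool) : ℕ := ∑ j ∈ Finset.range 64, if c j = true then wt j else 0

/-- Face-`1` sum along axis `a`: `Σ_{j : bit a set, c} wtE(a,j)`. [this work] -/
def ST (a : ℕ) (c : ℕ → Bool) : ℕ := ∑ j ∈ Finset.range 64, if (j.testBit a && c j) = true then wtE a j else 0

/-- Face-`0` sum along axis `a`: `Σ_{j : bit a clear, c} wtE(a,j)`. [this work] -/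
def SB (a : ℕ) (c : ℕ → Bool) : ℕ := ∑ j ∈ Finset.range 64, if (!j.testBit a && c j) = true then wtE a j else 0

/-- `w·𝟙_c` summed in `ℝ` is the cast of `SF c`. [this work] -/
theorem sum_full_cast (c : ℕ → Bool) :
    (∑ j ∈ Finset.range 64, (wt j : ℝ) * (if c j = true then 1 else 0)) = (SF c : ℝ) := by
  rw [SF]; push_cast
  refine Finset.sum_congr rfl fun j _ => ?_
  split_ifs <;> simp

/-- Face-`1` version: the cast of `ST a c`. [this work] -/
theorem sum_top_cast (c : ℕ → Bool) (a : ℕ) :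
    (∑ j ∈ Finset.range 64, (if j.testBit a = true then (wtE a j : ℝ) * (if c j = true then 1 else 0) else 0)) =
      (ST a c : ℝ) := by
  rw [ST]; push_cast
  refine Finset.sum_congr rfl fun j _ => ?_
  cases hj : j.testBit a <;> cases hc : c j <;> simp

/-- Face-`0` version: the cast of `SB a c`. [this work] -/
theorem sum_bot_cast (c : ℕ → Bool) (a : ℕ) :
    (∑ j ∈ Finset.range 64, (if j.testBit a = true then 0 else (wtE a j : ℝ) * (if c j = true then 1 else 0))) =
      (SB a c : ℝ) := by
  rw [SB]; push_cast
  refine Finset.sum_congr rfl fun j _ => ?_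
  cases hj : j.testBit a <;> cases hc : c j <;> simp

/-- The seven bulk counts at `q ≡ 9/10` (kernel computation over `j < 64`): singles `989901`, pairs `980100`, triple `970299`. [this work] -/
theorem counts_full :
    SF bA = 989901 ∧ SF bB = 989901 ∧ SF bC = 989901 ∧ SF (fun j => bA j && bB j) = 980100 ∧ SF (fun j => bA j && bC j) = 980100 ∧
      SF (fun j => bB j && bC j) = 980100 ∧ SF (fun j => bA j && bB j && bC j) = 970299 := by
  decide

/-- **Kernel identity on the face `x_a = 1`, uniformly in the axis**: `10¹⁵·Φ_a(1) = 0` for all six `a`. [this work] -/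
theorem top_identity : ∀ a : Fin 6,
    2 * 10000000000 * ST a (fun j => bA j && bB j && bC j) + ST a bA * ST a bB * ST a bC =
      100000 * (ST a bA * ST a (fun j => bB j && bC j) + ST a bB * ST a (fun j => bA j && bC j) +
        ST a bC * ST a (fun j => bA j && bB j)) := by
  decide

/-- **Kernel identity on the face `x_a = 0`, uniformly in the axis**: `10¹⁵·Φ_a(0) = 1058419791` for all six `a`. [this work] -/
theorem bot_identity : ∀ a : Fin 6,
    2 * 10000000000 * SB a (fun j => bA j && bB j && bC j) + SB a bA * SB a bB * SB a bC =
      100000 * (SB a bA * SB a (fun j => bB j && bC j) + SB a bB * SB a (fun j => bA j && bC j) +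
        SB a bC * SB a (fun j => bA j && bB j)) + 1058419791 := by
  decide

/-! ### 3. The values of `E_3`: the bulk and the two sections along every axis -/

/-- **`E_3(μ_{9/10}; A, B, C) = 29107999701/10¹⁸`.** [this work] -/
theorem sahiE_three_q910 :
    sahiE (bernoulliWeight q910) 3 ![ind dsA, ind dsB, ind dsC] = 29107999701 / 1000000000000000000 := by
  rw [sahiE_three]
  simp only [ex_q910, Pi.mul_apply, ind_eq_ite _ _ _ (mem_dsA _), ind_eq_ite _ _ _ (mem_dsB _), ind_eq_ite _ _ _ (mem_dsC _),
    SahiCoordinateTwoThirdsFalse.ite_mul_ite, sum_full_cast]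
  obtain ⟨h1, h2, h3, h4, h5, h6, h7⟩ := counts_full
  have e : (2 * 1000000000000 * (SF (fun j => bA j && bB j && bC j) : ℝ) + (SF bA : ℝ) * SF bB * SF bC -
      1000000 * ((SF bA : ℝ) * SF (fun j => bB j && bC j) + (SF bB : ℝ) * SF (fun j => bA j && bC j) +
        (SF bC : ℝ) * SF (fun j => bA j && bB j))) = 29107999701 := by
    rw [h1, h2, h3, h4, h5, h6, h7]; norm_num
  linear_combination e / 1000000000000000000

/-- **The `1`-sections have `E_3 = 0` along every axis** (`Φ_a(1) = 0`: one pair-letter becomes sure). [this work] -/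
theorem sahiE_three_top (a : Fin 6) : sahiE (bernoulliWeight (update q910 a 1)) 3 ![ind dsA, ind dsB, ind dsC] = 0 := by
  rw [sahiE_three]
  simp only [ex_top, Pi.mul_apply, ind_eq_ite _ _ _ (mem_dsA _), ind_eq_ite _ _ _ (mem_dsB _), ind_eq_ite _ _ _ (mem_dsC _),
    SahiCoordinateTwoThirdsFalse.ite_mul_ite, sum_top_cast]
  have h' : (2 * 10000000000 * (ST a (fun j => bA j && bB j && bC j) : ℝ) + (ST a bA : ℝ) * ST a bB * ST a bC =
      100000 * ((ST a bA : ℝ) * ST a (fun j => bB j && bC j) + (ST a bB : ℝ) * ST a (fun j => bA j && bC j) +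
        (ST a bC : ℝ) * ST a (fun j => bA j && bB j))) := by
    exact_mod_cast top_identity a
  linear_combination h' / 1000000000000000

/-- **The `0`-sections have `E_3 = 1058419791/10¹⁵` along every axis** (`Φ_a(0)`). [this work] -/
theorem sahiE_three_bot (a : Fin 6) :
    sahiE (bernoulliWeight (update q910 a 0)) 3 ![ind dsA, ind dsB, ind dsC] = 1058419791 / 1000000000000000 := by
  rw [sahiE_three]
  simp only [ex_bot, Pi.mul_apply, ind_eq_ite _ _ _ (mem_dsA _), ind_eq_ite _ _ _ (mem_dsB _), ind_eq_ite _ _ _ (mem_dsC _),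
    SahiCoordinateTwoThirdsFalse.ite_mul_ite, sum_bot_cast]
  have h' : (2 * 10000000000 * (SB a (fun j => bA j && bB j && bC j) : ℝ) + (SB a bA : ℝ) * SB a bB * SB a bC =
      100000 * ((SB a bA : ℝ) * SB a (fun j => bB j && bC j) + (SB a bB : ℝ) * SB a (fun j => bA j && bC j) +
        (SB a bC : ℝ) * SB a (fun j => bA j && bB j)) + 1058419791) := by
    exact_mod_cast bot_identity a
  linear_combination h' / 1000000000000000

/-! ### 4. The refutations -/

/-- **Every sectional chord exceeds `3.63·E_3`**: along each of the six axes
`(1 − q_a)·E_3(μ_{q[a↦0]}) + q_a·E_3(μ_{q[a↦1]}) = 1058419791/10¹⁶ > (36/10)·E_3(μ_q)` (and `E_3(μ_q) > 0`). [this work] -/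
theorem chord_gt (a : Fin 6) :
    (36 / 10 : ℝ) * sahiE (bernoulliWeight q910) 3 ![ind dsA, ind dsB, ind dsC] <
      (1 - ((q910 a : unitInterval) : ℝ)) * sahiE (bernoulliWeight (update q910 a 0)) 3 ![ind dsA, ind dsB, ind dsC] +
        ((q910 a : unitInterval) : ℝ) * sahiE (bernoulliWeight (update q910 a 1)) 3 ![ind dsA, ind dsB, ind dsC] := by
  rw [sahiE_three_q910, sahiE_three_bot, sahiE_three_top, coe_q910]
  norm_num

/-- `E_3(μ_q) > 0` at the witness (so the failure is not a sign artefact). [this work] -/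
theorem sahiE_three_q910_pos : 0 < sahiE (bernoulliWeight q910) 3 ![ind dsA, ind dsB, ind dsC] := by
  rw [sahiE_three_q910]; norm_num

/-- **The per-coin chord bound PCB(2) is false**: there are a finite cube, a product measure with all biases in `(0,1)`, three
increasing events with `E_3 > 0` and a coin `a` along which `2·E_3(μ_q) < (1 − q_a)·E_3(μ_{q[a↦0]}) + q_a·E_3(μ_{q[a↦1]})`
("`E_3` dominates half the average of its two facets" fails; here even `E_3 < 0.28 ×` that average, on every axis). [this work] -/
theorem not_perCoinChordBound_two :
    ∃ (q : Fin 6 → unitInterval) (A B C : Set (Set (Fin 6))) (a : Fin 6),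
      IsUpperSet A ∧ IsUpperSet B ∧ IsUpperSet C ∧ (∀ i, 0 < ((q i : unitInterval) : ℝ) ∧ ((q i : unitInterval) : ℝ) < 1) ∧
      0 < sahiE (bernoulliWeight q) 3 ![ind A, ind B, ind C] ∧
      2 * sahiE (bernoulliWeight q) 3 ![ind A, ind B, ind C] <
        (1 - ((q a : unitInterval) : ℝ)) * sahiE (bernoulliWeight (update q a 0)) 3 ![ind A, ind B, ind C] +
          ((q a : unitInterval) : ℝ) * sahiE (bernoulliWeight (update q a 1)) 3 ![ind A, ind B, ind C] := by
  refine ⟨q910, dsA, dsB, dsC, 0, isUpperSet_dsA, isUpperSet_dsB, isUpperSet_dsC, fun i => ?_, sahiE_three_q910_pos, ?_⟩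
  · rw [coe_q910]; norm_num
  · have h := chord_gt 0
    have hp := sahiE_three_q910_pos
    linarith

/-- **The six sectional chords together exceed `21.8·E_3 > (6+1)·E_3`.** [this work] -/
theorem sum_chord_gt :
    (218 / 10 : ℝ) * sahiE (bernoulliWeight q910) 3 ![ind dsA, ind dsB, ind dsC] <
      ∑ a : Fin 6, ((1 - ((q910 a : unitInterval) : ℝ)) * sahiE (bernoulliWeight (update q910 a 0)) 3 ![ind dsA, ind dsB, ind dsC] +
        ((q910 a : unitInterval) : ℝ) * sahiE (bernoulliWeight (update q910 a 1)) 3 ![ind dsA, ind dsB, ind dsC]) := by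
  simp only [sahiE_three_q910, sahiE_three_bot, sahiE_three_top, coe_q910, Finset.sum_const, Finset.card_univ,
    Fintype.card_fin, nsmul_eq_mul]
  norm_num

/-- **The chord-sum bound CSB is false**: on `m = 6` coins there are a product measure with biases in `(0,1)` and three increasing
events with `E_3 > 0` such that `Σ_a [(1 − q_a)·E_3(μ_{q[a↦0]}) + q_a·E_3(μ_{q[a↦1]})] > (m + 1)·E_3(μ_q)`
(`E_3` does NOT dominate `m/(m+1)` times the average of its `2m` facets; equivalently `W/2 + A₃ ≤ E_3` fails away from critical points). [this work] -/
theorem not_chordSumBound :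
    ∃ (q : Fin 6 → unitInterval) (A B C : Set (Set (Fin 6))),
      IsUpperSet A ∧ IsUpperSet B ∧ IsUpperSet C ∧ (∀ i, 0 < ((q i : unitInterval) : ℝ) ∧ ((q i : unitInterval) : ℝ) < 1) ∧
      0 < sahiE (bernoulliWeight q) 3 ![ind A, ind B, ind C] ∧
      ((6 : ℕ) + 1 : ℝ) * sahiE (bernoulliWeight q) 3 ![ind A, ind B, ind C] <
        ∑ a : Fin 6, ((1 - ((q a : unitInterval) : ℝ)) * sahiE (bernoulliWeight (update q a 0)) 3 ![ind A, ind B, ind C] +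
          ((q a : unitInterval) : ℝ) * sahiE (bernoulliWeight (update q a 1)) 3 ![ind A, ind B, ind C]) := by
  refine ⟨q910, dsA, dsB, dsC, isUpperSet_dsA, isUpperSet_dsB, isUpperSet_dsC, fun i => ?_, sahiE_three_q910_pos, ?_⟩
  · rw [coe_q910]; norm_num
  · have h := sum_chord_gt
    have hp := sahiE_three_q910_pos
    push_cast
    linarith

end SahiChordBoundsFalse

end Summit.CriticalPhenomena.PercolationContinuityZ3.Theorems
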